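import Mathlib
import Literature.LinearAlgebra.Matrix.HermitianCfcDiagonalForm
import Literature.MathematicalPhysics.QuantumFieldTheory.Balaban1983to89.B14Sect3
import Literature.MathematicalPhysics.QuantumFieldTheory.Balaban1983to89.B13Sqrt27
import Literature.MathematicalPhysics.QuantumFieldTheory.Balaban1983to89.B10LogDet63

/-!
# `Balaban1983to89.B14LogDet336Matrix` — [Balaban1988Convergent] (3.34)₁, (3.36), (3.37)₁ pp. 273–274: the
# `−½ log det` / resolvent-integral calculus of the k+1-st step AT OPERATOR LEVEL (every finite dimension), with the
# sign erratum of (3.36)/(3.37) and the per-bond bookkeeping behind (3.38) kernel-checked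

CITATION HEADER (lean-in-tree rule).  Source: T. Bałaban, *Convergent renormalization expansions for lattice gauge
theories*, Commun. Math. Phys. **119**, 243–285 (1988), doi:10.1007/bf01217741 (cell paper B14; held:
`paper:balaban1988-cmp119-convergent-renormalization`; journal page = PDF page + 242; the quotations below were read from
the page renders `…-p031-x2.png` (p. 273) and `…-p032-x2.png` (p. 274), READ AS IMAGES, the OCR layer being used for
orientation only).  ADDITIVE LEAF: sibling of `…B14Sect3` (whose §D COMPUTES the 1×1 instance of (3.36):
`integral_resolvent_scalar`, `logdet_scalar_336_corrected`, `logdet_scalar_336_printed_sign_fails`, and types (3.35) as ring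
algebra, `resolvent_identity_335`), which it imports and does not modify; it re-uses BY NAME the operator-level log-det
calculus the cell already kernel-checked for [Balaban1985UV3] (63) (`…B10LogDet63`: `log_det_eq_sum`, `diff61_Ioi`,
`integral_Ioi_inv_sub_inv`), the resolvent-as-matrix-function lemma `…B13Sqrt27.resolvent_eq_cfc`, and the tree's
`Literature.LinearAlgebra.Matrix.cfc_apply_eq_sum` / `trace_cfc_eq_sum_eigenvalues` (entries and trace of a matrix
function from a unitary diagonalisation).  None of those modules is modified.

WHAT IS REPRODUCED, verbatim.  p. 273 [PDF 31]: *"The first term has already the localized form, so we consider the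
second term. We have − ½ log det(C*Δ^{(k)}C) = − ½ Tr log(C*Δ^{(k)}C) = (1/(4πi)) ∫_γ dz log z Tr(C*Δ^{(k)}C − zI)⁻¹, (3.34)
where the contour γ surrounds the spectrum of C*Δ^{(k)}C, e.g. we take γ composed of a segment of the circle |z| = R for
R large enough, and of an interval on the line Re z = r, r positive and small. We take λ₀ > r, but small enough, and we
expand the resolvent in (3.34) as follows: (C*Δ^{(k)}C − zI)⁻¹ = (λ₀ − z)⁻¹I − (λ₀ − z)⁻¹(C*Δ^{(k)}C − λ₀I)(C*Δ^{(k)}C − zI)⁻¹.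
(3.35)"*.  p. 274 [PDF 32]: *"The integral of the first term on the right-hand side is equal to −1/2 log λ₀I. The second
term is O(|z|⁻²) as |z| → ∞, hence we can replace the contour of integration by the contour {z : Im z = −r, Re z ≦ 0} ∪
{z : Re z = 0, |Im z| ≦ r} ∪ {z : Im z = r, Re z ≦ 0}, and next take the limit as r → 0. This yields
− ½ log det(C*Δ^{(k)}C) = − ½ log λ₀ |Λ^{(k)*}_{k+1}| + ½ ∫₀^∞ dλ (λ₀ + λ)⁻¹ Tr(C*Δ^{(k)}C − λ₀I)(C*Δ^{(k)}C + λI)⁻¹. (3.36)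
Let us introduce the following definiton: 𝐄₀^{(k+1)}(Λ_{k+1}, U_{k+1}, b) = χ_{Λ^{(k)*}_{k+1}}(b)[− ½ log λ₀ + ½ ∫₀^∞ dλ
(λ₀ + λ)⁻¹ · tr((C*Δ^{(k)}C − λ₀I)(C*Δ^{(k)}C + λ)⁻¹)(b, b) + ∫₀¹ dt ∫ dμ_{C^{(k)}(Λ_{k+1})} Π_{b′∈Λ^{(k)*}_{k+1}, b′≠b} χ^{(k)}(tA(b′))
(∂/∂t) χ^{(k)}(tA(b)) · (∫ dμ_{C^{(k)}(Λ₊₁)} χ_t^{(k)})⁻¹] + g_k ∫₀¹ dt ⟨tr 𝐕′_k(tg_k, A, b)(CA)(b)⟩_t. (3.37)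
The identities (3.30)–(3.33), (3.36), together with the above definition, imply the equality [the logarithm on the
right-hand side of (3.28)] = Σ_{c∈Λ^{(k+1)}_{k+1}} log z^{(k)}(c) + Σ_{b∈Λ^{(k)}_{k+1}} 𝐄₀^{(k+1)}(Λ_{k+1}, b) + const. (3.38)"*
("definiton", "Λ₊₁" sic).

WHAT IS KERNEL-CERTIFIED (theorems about a positive definite real symmetric matrix `T` on a finite index type `n` —
the finite-dimensional model of *"the positive … operator C*Δ^{(k)}C"* on the space of fluctuation fields on
Λ^{(k)*}_{k+1} — and about real integrals; `λ₀ > 0` arbitrary):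
* (3.34), first equality: `log det T = Tr log T` with `log T = cfc Real.log T` the matrix function
  (`log_det_eq_trace_log`, `eq334_first`);
* (3.36) at operator level, WITH THE CORRECTED SIGN of cell DIVERGENCE.md D-pv02.5 (the 1×1 computation of `…B14Sect3`):
  the integrand `(λ₀ + λ)⁻¹ Tr(T − λ₀I)(T + λI)⁻¹` is integrable on (0, ∞) and
  `−½ log det T = −½ log λ₀ · Tr I − ½ ∫₀^∞ dλ (λ₀ + λ)⁻¹ Tr(T − λ₀I)(T + λI)⁻¹` (`integral_336`, `eq336_corrected`),
  obtained from the cell's whole-half-line (61)-identity `…B10LogDet63.diff61_Ioi` at `T₀ = λ₀I` through the algebra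
  `(λ₀ + λ)⁻¹ Tr(T − λ₀I)(T + λI)⁻¹ = (λ₀ + λ)⁻¹ Tr I − Tr(T + λI)⁻¹` (`integrand_336_eq`, i.e. (3.35) at z = −λ, traced);
  the sign AS PRINTED holds IF AND ONLY IF `det T = λ₀^{Tr I}` (`eq336_printed_iff`), so it fails for every scalar
  matrix `μI ≠ λ₀I` in every dimension ≥ 1 (`eq336_printed_fails_smul_one`; the 1×1 witness is
  `B14Sect3.logdet_scalar_336_printed_sign_fails`).  The coefficient of `log λ₀` the kernel produces is `Tr I =
  Fintype.card n`, the dimension of the space `T` acts on (B14 prints `|Λ^{(k)*}_{k+1}|`; cf. cell GAPS.md G-adv4-26 (b)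
  on the count `½ Tr I` — this file states the linear algebra and does not adjudicate what `|Λ^{(k)*}_{k+1}|` denotes);
* (3.37), first bracket, PER DIAGONAL ENTRY, and the (3.38) bookkeeping for it: for EVERY index `i` the bond-wise
  integrand `(λ₀ + λ)⁻¹((T − λ₀I)(T + λI)⁻¹)(i, i)` is SEPARATELY integrable on (0, ∞) with
  `∫₀^∞ = (log T)(i, i) − log λ₀` (`integral_337_diag`; eigen-expansion `resolvent_apply_eq_sum`,
  `integrand_337_diag_eq`), hence the corrected first bracket equals `−½ (log T)(i, i)` (`eq337_first_corrected`) and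
  its sum over all indices is `−½ Tr log T = −½ log det T`, i.e. the first part of (3.37) summed over b reproduces (3.36)
  (`sum_eq337_first`); grouped along an arbitrary fibre map `bond : n → β` ("tr( · )(b, b)" = the sum of the diagonal
  entries in the fibre of b) the per-bond constant is `−½ log λ₀ · |fibre b|` and `Σ_b` of the per-bond brackets is again
  `−½ log det T` (`sum_fiber_eq337_first`).
Every certified declaration is [folklore] (finite-dimensional spectral calculus + one real integral); the quotations are
reproduced for what the paper PRINTS, the sign divergence being a kernel theorem, not a citation.

WHAT IS *NOT* REPRODUCED OR ASSERTED: the operator `C*Δ^{(k)}C` itself, its positivity and the lower bound `λ₀ > r` of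
its spectrum (p. 273, uncited in print — cell GAPS.md G-B14s-11), the contour representation (3.34)₂ and the contour
deformation of p. 274 (the certified route to (3.36) is the real-variable one, eigenvalue by eigenvalue), the remaining
terms of (3.37) (characteristic functions, the `g_k`-term), (3.38) beyond its first-bracket part, and anything about
random-walk expansions of `(C*Δ^{(k)}C + λ)⁻¹`.  Nothing of the series is asserted; value = kernel certificate of the
printed operator calculus in every finite dimension + the print erratum D-pv02.5 settled at operator level, NOT summit
progress.  Unit `b2b-balaban-pv02` (surge node prover #02; B14 Sects. 1+3 = PHASE-2 row P14), gen 23, journal claim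
`G-B14-EQ336-LOGDET-MATRIX`; companion rows: GAPS.md C-pv02g23-1, DIVERGENCE.md D-pv02.5, GAPS.md G-adv4-26, G-adv6-16,
C-adv4-49.

ABSOLUTE RULE observed: no internally-minted statement enters as a cited fact; every hypothesis of every theorem is
displayed; the manuscript under audit is quoted for its printed text only.

## References
* [Balaban1988Convergent] T. Bałaban, Commun. Math. Phys. 119 (1988) 243–285, (3.34)–(3.38) pp. 273–274.
* [Balaban1985UV3] T. Bałaban, Commun. Math. Phys. 102 (1985) 255–275, (61)–(63) pp. 271–272 (the operator log-det
  calculus re-used by name from `…B10LogDet63`).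
* [HornJohnson2013] R. A. Horn, C. R. Johnson, *Matrix Analysis*, 2nd ed., §4.1 (functions of a Hermitian matrix from a
  unitary diagonalisation; `Literature.LinearAlgebra.Matrix.cfc_apply_eq_sum`).
-/

noncomputable section

open MeasureTheory Set Filter Matrix Finset
open scoped Real Topology

namespace Literature.MathematicalPhysics.QuantumFieldTheory.Balaban1983to89.B14LogDet336Matrix

open Literature.MathematicalPhysics.QuantumFieldTheory.Balaban1983to89
open Literature.LinearAlgebra.Matrix (cfc_apply_eq_sum trace_cfc_eq_sum_eigenvalues)

variable {n : Type*} [Fintype n] [DecidableEq n] {T : Matrix n n ℝ}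

/-! ## §1. (3.34), first equality: `log det = Tr log` -/

/-- **(3.34), first equality** (p. 273 [PDF 31], verbatim): *"− ½ log det(C*Δ^{(k)}C) = − ½ Tr log(C*Δ^{(k)}C)"* — for a
positive definite real symmetric matrix `T`, with `log T := cfc Real.log T` the matrix function:
`log det T = Tr log T`. [folklore] -/
theorem log_det_eq_trace_log (hT : T.PosDef) : Real.log T.det = trace (cfc Real.log T) := by
  rw [B10LogDet63.log_det_eq_sum hT, trace_cfc_eq_sum_eigenvalues hT.1 Real.log]
  simp only [RCLike.ofReal_real_eq_id, id_eq]

/-- (3.34)₁ in the printed shape `−½ log det T = −½ Tr log T`. [cite: Balaban1988Convergent, (3.34) p.273] -/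
theorem eq334_first (hT : T.PosDef) :
    -(1 / 2 : ℝ) * Real.log T.det = -(1 / 2 : ℝ) * trace (cfc Real.log T) := by
  rw [log_det_eq_trace_log hT]

/-! ## §2. (3.36) at operator level (corrected sign) -/

omit [Fintype n] in
/-- `λ₀I` is positive definite for `λ₀ > 0`. [folklore] -/
theorem posDef_smul_one {lam0 : ℝ} (h0 : 0 < lam0) : (lam0 • (1 : Matrix n n ℝ)).PosDef :=
  Matrix.PosDef.one.smul h0

/-- `log det(λ₀I) = Tr I · log λ₀` (for every real `λ₀`, with Mathlib's `Real.log`). [folklore] -/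
theorem log_det_smul_one (lam0 : ℝ) :
    Real.log (lam0 • (1 : Matrix n n ℝ)).det = Fintype.card n * Real.log lam0 := by
  rw [det_smul, det_one, mul_one, Real.log_pow]

omit [Fintype n] in
/-- `T + λI` is positive definite, hence invertible, for `λ ≥ 0`. [folklore] -/
theorem posDef_add_smul_one (hT : T.PosDef) {x : ℝ} (hx : 0 ≤ x) : (T + x • (1 : Matrix n n ℝ)).PosDef :=
  hT.add_posSemidef (Matrix.PosSemidef.one.smul hx)

/-- `det(T + λI)` is a unit for `λ ≥ 0`. [folklore] -/
theorem isUnit_det_add_smul_one (hT : T.PosDef) {x : ℝ} (hx : 0 ≤ x) :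
    IsUnit (T + x • (1 : Matrix n n ℝ)).det :=
  (isUnit_iff_isUnit_det _).mp (posDef_add_smul_one hT hx).isUnit

/-- **(3.35) at `z = −λ`, multiplied out**: `(T − λ₀I)(T + λI)⁻¹ = I − (λ₀ + λ)(T + λI)⁻¹` for `λ ≥ 0`. [folklore] -/
theorem sub_mul_resolvent (hT : T.PosDef) (lam0 : ℝ) {x : ℝ} (hx : 0 ≤ x) :
    (T - lam0 • (1 : Matrix n n ℝ)) * (T + x • 1)⁻¹ = 1 - (lam0 + x) • (T + x • 1)⁻¹ := by
  have h1 : (T + x • (1 : Matrix n n ℝ)) * (T + x • 1)⁻¹ = 1 :=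
    mul_nonsing_inv _ (isUnit_det_add_smul_one hT hx)
  have h2 : T - lam0 • (1 : Matrix n n ℝ) = (T + x • 1) - (lam0 + x) • 1 := by
    rw [add_smul]; abel
  rw [h2, sub_mul, h1, Matrix.smul_mul, one_mul]

/-- The integrand of (3.36), traced through (3.35): for `λ ≥ 0` with `λ₀ + λ ≠ 0`,
`(λ₀ + λ)⁻¹ Tr(T − λ₀I)(T + λI)⁻¹ = (λ₀ + λ)⁻¹ Tr I − Tr(T + λI)⁻¹`. [folklore] -/
theorem integrand_336_eq (hT : T.PosDef) {lam0 x : ℝ} (hx : 0 ≤ x) (hl : lam0 + x ≠ 0) :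
    (lam0 + x)⁻¹ * trace ((T - lam0 • (1 : Matrix n n ℝ)) * (T + x • 1)⁻¹)
      = (lam0 + x)⁻¹ * Fintype.card n - trace ((T + x • (1 : Matrix n n ℝ))⁻¹) := by
  rw [sub_mul_resolvent hT lam0 hx, trace_sub, trace_smul, trace_one, smul_eq_mul, mul_sub,
    ← mul_assoc, inv_mul_cancel₀ hl, one_mul]

/-- `Tr(λI + λ₀I)⁻¹ = (λ₀ + λ)⁻¹ Tr I` for `λ₀ + λ ≠ 0`. [folklore] -/
theorem trace_inv_smul_one_add {lam0 x : ℝ} (hl : lam0 + x ≠ 0) :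
    trace ((x • (1 : Matrix n n ℝ) + lam0 • 1)⁻¹) = (lam0 + x)⁻¹ * Fintype.card n := by
  have h : (x • (1 : Matrix n n ℝ) + lam0 • 1)⁻¹ = (lam0 + x)⁻¹ • 1 := by
    refine inv_eq_left_inv ?_
    rw [← add_smul, Matrix.smul_mul, one_mul, smul_smul, add_comm x lam0, inv_mul_cancel₀ hl, one_smul]
  rw [h, trace_smul, trace_one, smul_eq_mul]

/-- **(3.36) at operator level, corrected sign** — the integral: for `T` positive definite real symmetric and any
`λ₀ > 0`, the function `λ ↦ (λ₀ + λ)⁻¹ Tr(T − λ₀I)(T + λI)⁻¹` is integrable on `(0, ∞)` and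
`∫₀^∞ dλ (λ₀ + λ)⁻¹ Tr(T − λ₀I)(T + λI)⁻¹ = log det T − Tr I · log λ₀`.  From `B10LogDet63.diff61_Ioi` with
`T₀ = λ₀I`, `T₁ = T`. [folklore] -/
theorem integral_336 (hT : T.PosDef) {lam0 : ℝ} (h0 : 0 < lam0) :
    IntegrableOn (fun x : ℝ => (lam0 + x)⁻¹ * trace ((T - lam0 • (1 : Matrix n n ℝ)) * (T + x • 1)⁻¹)) (Ioi 0) ∧
    ∫ x in Ioi (0 : ℝ), (lam0 + x)⁻¹ * trace ((T - lam0 • (1 : Matrix n n ℝ)) * (T + x • 1)⁻¹)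
      = Real.log T.det - Fintype.card n * Real.log lam0 := by
  have h61 := B10LogDet63.diff61_Ioi (posDef_smul_one (n := n) h0) hT
  have heq : EqOn (fun x : ℝ => (lam0 + x)⁻¹ * trace ((T - lam0 • (1 : Matrix n n ℝ)) * (T + x • 1)⁻¹))
      (fun x : ℝ => trace ((x • (1 : Matrix n n ℝ) + lam0 • 1)⁻¹) - trace ((x • (1 : Matrix n n ℝ) + T)⁻¹))
      (Ioi 0) := by
    intro x hx
    have hx' : 0 ≤ x := le_of_lt hx
    have hl : lam0 + x ≠ 0 := by have : (0 : ℝ) < x := hx; positivity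
    simp only
    rw [integrand_336_eq hT hx' hl, trace_inv_smul_one_add hl, add_comm (x • (1 : Matrix n n ℝ)) T]
  refine ⟨h61.1.congr_fun heq.symm measurableSet_Ioi, ?_⟩
  rw [setIntegral_congr_fun measurableSet_Ioi heq, h61.2, log_det_smul_one lam0]

/-- **(3.36) WITH THE CORRECTED SIGN "−½∫", at operator level**:
`−½ log det T = −½ log λ₀ · Tr I − ½ ∫₀^∞ dλ (λ₀ + λ)⁻¹ Tr(T − λ₀I)(T + λI)⁻¹` (Tr I = `Fintype.card n`).
The printed display carries "+½∫" (cell DIVERGENCE.md D-pv02.5; `eq336_printed_iff` below). [folklore] -/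
theorem eq336_corrected (hT : T.PosDef) {lam0 : ℝ} (h0 : 0 < lam0) :
    -(1 / 2 : ℝ) * Real.log T.det
      = -(1 / 2 : ℝ) * Real.log lam0 * Fintype.card n
        - (1 / 2 : ℝ) * ∫ x in Ioi (0 : ℝ),
            (lam0 + x)⁻¹ * trace ((T - lam0 • (1 : Matrix n n ℝ)) * (T + x • 1)⁻¹) := by
  rw [(integral_336 hT h0).2]; ring

/-- **The sign AS PRINTED in (3.36)** (*"+ ½ ∫₀^∞ dλ (λ₀ + λ)⁻¹ Tr(C*Δ^{(k)}C − λ₀I)(C*Δ^{(k)}C + λI)⁻¹"*) holds for a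
positive definite `T` and `λ₀ > 0` IF AND ONLY IF `det T = λ₀^{Tr I}`: the printed identity is off by the sign of the
integral, which vanishes exactly in that case.  (Harmless for the paper — (3.36) and (3.37) carry the same sign and
p. 280 bounds the bracket of (3.37) in absolute value; cell DIVERGENCE.md D-pv02.5.)
[cite: Balaban1988Convergent, (3.36) p.274] -/
theorem eq336_printed_iff (hT : T.PosDef) {lam0 : ℝ} (h0 : 0 < lam0) :
    (-(1 / 2 : ℝ) * Real.log T.det
        = -(1 / 2 : ℝ) * Real.log lam0 * Fintype.card n
          + (1 / 2 : ℝ) * ∫ x in Ioi (0 : ℝ),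
              (lam0 + x)⁻¹ * trace ((T - lam0 • (1 : Matrix n n ℝ)) * (T + x • 1)⁻¹))
      ↔ T.det = lam0 ^ Fintype.card n := by
  rw [(integral_336 hT h0).2]
  constructor
  · intro h
    have hlog : Real.log T.det = Real.log (lam0 ^ Fintype.card n) := by
      rw [Real.log_pow]; linarith
    exact Real.log_injOn_pos hT.det_pos (pow_pos h0 _) hlog
  · intro h
    rw [h, Real.log_pow]; ring

/-- Hence the printed sign FAILS in every dimension ≥ 1, e.g. for every scalar matrix `T = μI` with `0 < μ ≠ λ₀`
(the 1×1 witness is `B14Sect3.logdet_scalar_336_printed_sign_fails`). [cite: Balaban1988Convergent, (3.36) p.274] -/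
theorem eq336_printed_fails_smul_one [Nonempty n] {lam0 μ : ℝ} (h0 : 0 < lam0) (hμ : 0 < μ) (hne : μ ≠ lam0) :
    ¬ (-(1 / 2 : ℝ) * Real.log (μ • (1 : Matrix n n ℝ)).det
        = -(1 / 2 : ℝ) * Real.log lam0 * Fintype.card n
          + (1 / 2 : ℝ) * ∫ x in Ioi (0 : ℝ),
              (lam0 + x)⁻¹ * trace ((μ • (1 : Matrix n n ℝ) - lam0 • (1 : Matrix n n ℝ))
                * (μ • (1 : Matrix n n ℝ) + x • 1)⁻¹)) := by
  rw [eq336_printed_iff (posDef_smul_one hμ) h0, det_smul, det_one, mul_one,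
    pow_left_inj₀ hμ.le h0.le Fintype.card_ne_zero]
  exact hne

/-! ## §3. (3.37), first bracket, PER DIAGONAL ENTRY, and the (3.38) bookkeeping for it -/

/-- The rows of the eigenvector matrix `V` of a real symmetric `T` (Mathlib's `eigenvectorUnitary`, `T = V diag(μ) Vᵀ`)
are unit vectors: `Σ_k V_{ik}² = 1`. [folklore] -/
theorem eigenvectorUnitary_row_sum_sq (hA : T.IsHermitian) (i : n) :
    ∑ k, (hA.eigenvectorUnitary : Matrix n n ℝ) i k ^ 2 = 1 := by
  have hV : (hA.eigenvectorUnitary : Matrix n n ℝ) * star (hA.eigenvectorUnitary : Matrix n n ℝ) = 1 :=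
    Matrix.mem_unitaryGroup_iff.mp hA.eigenvectorUnitary.2
  have h := congr_fun (congr_fun hV i) i
  simpa [Matrix.mul_apply, Matrix.star_apply, sq] using h

/-- **Entries of the resolvent** `(T + λI)⁻¹`, `λ ≥ 0`, through the diagonalisation `T = V diag(μ) Vᵀ`:
`((T + λI)⁻¹)(i, j) = Σ_k V_{ik} (λ + μ_k)⁻¹ V_{jk}` (from `B13Sqrt27.resolvent_eq_cfc` and the tree's
`cfc_apply_eq_sum`). [folklore] -/
theorem resolvent_apply_eq_sum (hT : T.PosDef) {x : ℝ} (hx : 0 ≤ x) (i j : n) :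
    (T + x • (1 : Matrix n n ℝ))⁻¹ i j
      = ∑ k, (hT.1.eigenvectorUnitary : Matrix n n ℝ) i k * (x + hT.1.eigenvalues k)⁻¹
          * (hT.1.eigenvectorUnitary : Matrix n n ℝ) j k := by
  rw [add_comm, B13Sqrt27.resolvent_eq_cfc hT hx,
    cfc_apply_eq_sum hT.1.eigenvectorUnitary.2 hT.1.spectral_theorem (fun t : ℝ => (x + t)⁻¹) i j]
  simp only [RCLike.ofReal_real_eq_id, id_eq, star_trivial]

/-- **Entries of the matrix logarithm**: `(log T)(i, j) = Σ_k V_{ik} log μ_k V_{jk}`. [folklore] -/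
theorem log_apply_eq_sum (hT : T.PosDef) (i j : n) :
    (cfc Real.log T) i j
      = ∑ k, (hT.1.eigenvectorUnitary : Matrix n n ℝ) i k * Real.log (hT.1.eigenvalues k)
          * (hT.1.eigenvectorUnitary : Matrix n n ℝ) j k := by
  rw [cfc_apply_eq_sum hT.1.eigenvectorUnitary.2 hT.1.spectral_theorem Real.log i j]
  simp only [RCLike.ofReal_real_eq_id, id_eq, star_trivial]

/-- The bond-wise integrand of (3.37), eigenvalue by eigenvalue: for `λ ≥ 0`, `λ₀ + λ ≠ 0`,
`(λ₀ + λ)⁻¹((T − λ₀I)(T + λI)⁻¹)(i, i) = Σ_k V_{ik}² ((λ + λ₀)⁻¹ − (λ + μ_k)⁻¹)` (uses `Σ_k V_{ik}² = 1`). [folklore] -/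
theorem integrand_337_diag_eq (hT : T.PosDef) {lam0 x : ℝ} (hx : 0 ≤ x) (hl : lam0 + x ≠ 0) (i : n) :
    (lam0 + x)⁻¹ * ((T - lam0 • (1 : Matrix n n ℝ)) * (T + x • 1)⁻¹) i i
      = ∑ k, (hT.1.eigenvectorUnitary : Matrix n n ℝ) i k ^ 2
          * ((x + lam0)⁻¹ - (x + hT.1.eigenvalues k)⁻¹) := by
  have h1 := eigenvectorUnitary_row_sum_sq hT.1 i
  rw [sub_mul_resolvent hT lam0 hx, Matrix.sub_apply, Matrix.one_apply_eq, Matrix.smul_apply, smul_eq_mul,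
    resolvent_apply_eq_sum hT hx i i, mul_sub, ← mul_assoc, inv_mul_cancel₀ hl, one_mul, mul_one]
  calc (lam0 + x)⁻¹ - ∑ k, (hT.1.eigenvectorUnitary : Matrix n n ℝ) i k * (x + hT.1.eigenvalues k)⁻¹
          * (hT.1.eigenvectorUnitary : Matrix n n ℝ) i k
      = (∑ k, (hT.1.eigenvectorUnitary : Matrix n n ℝ) i k ^ 2) * (x + lam0)⁻¹
          - ∑ k, (hT.1.eigenvectorUnitary : Matrix n n ℝ) i k ^ 2 * (x + hT.1.eigenvalues k)⁻¹ := by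
        rw [h1, one_mul, add_comm lam0 x]
        congr 1
        exact Finset.sum_congr rfl fun k _ => by ring
    _ = ∑ k, (hT.1.eigenvectorUnitary : Matrix n n ℝ) i k ^ 2 * ((x + lam0)⁻¹ - (x + hT.1.eigenvalues k)⁻¹) := by
        rw [Finset.sum_mul, ← Finset.sum_sub_distrib]
        exact Finset.sum_congr rfl fun k _ => by ring

/-- **(3.37), first bracket, per diagonal entry** — the integral: for EVERY index `i`, the bond-wise integrand
`λ ↦ (λ₀ + λ)⁻¹((T − λ₀I)(T + λI)⁻¹)(i, i)` is (separately) integrable on `(0, ∞)` and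
`∫₀^∞ dλ (λ₀ + λ)⁻¹((T − λ₀I)(T + λI)⁻¹)(i, i) = (log T)(i, i) − log λ₀`. [folklore] -/
theorem integral_337_diag (hT : T.PosDef) {lam0 : ℝ} (h0 : 0 < lam0) (i : n) :
    IntegrableOn (fun x : ℝ => (lam0 + x)⁻¹ * ((T - lam0 • (1 : Matrix n n ℝ)) * (T + x • 1)⁻¹) i i) (Ioi 0) ∧
    ∫ x in Ioi (0 : ℝ), (lam0 + x)⁻¹ * ((T - lam0 • (1 : Matrix n n ℝ)) * (T + x • 1)⁻¹) i i
      = (cfc Real.log T) i i - Real.log lam0 := by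
  have hμpos : ∀ k, 0 < hT.1.eigenvalues k := hT.eigenvalues_pos
  have hsc : ∀ k, IntegrableOn (fun x : ℝ => (x + lam0)⁻¹ - (x + hT.1.eigenvalues k)⁻¹) (Ioi 0) ∧
      ∫ x in Ioi (0 : ℝ), ((x + lam0)⁻¹ - (x + hT.1.eigenvalues k)⁻¹)
        = Real.log (hT.1.eigenvalues k) - Real.log lam0 :=
    fun k => B10LogDet63.integral_Ioi_inv_sub_inv h0 (hμpos k)
  have heq : EqOn (fun x : ℝ => (lam0 + x)⁻¹ * ((T - lam0 • (1 : Matrix n n ℝ)) * (T + x • 1)⁻¹) i i)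
      (fun x : ℝ => ∑ k, (hT.1.eigenvectorUnitary : Matrix n n ℝ) i k ^ 2
          * ((x + lam0)⁻¹ - (x + hT.1.eigenvalues k)⁻¹)) (Ioi 0) := by
    intro x hx
    have hx' : 0 ≤ x := le_of_lt hx
    have hl : lam0 + x ≠ 0 := by have : (0 : ℝ) < x := hx; positivity
    exact integrand_337_diag_eq hT hx' hl i
  have hint : IntegrableOn (fun x : ℝ => ∑ k, (hT.1.eigenvectorUnitary : Matrix n n ℝ) i k ^ 2
      * ((x + lam0)⁻¹ - (x + hT.1.eigenvalues k)⁻¹)) (Ioi 0) :=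
    integrable_finsetSum _ fun k _ => ((hsc k).1.const_mul _)
  refine ⟨hint.congr_fun heq.symm measurableSet_Ioi, ?_⟩
  rw [setIntegral_congr_fun measurableSet_Ioi heq,
    integral_finsetSum _ (fun k _ => ((hsc k).1.const_mul _)), log_apply_eq_sum hT i i]
  have h1 := eigenvectorUnitary_row_sum_sq hT.1 i
  calc ∑ k, ∫ x in Ioi (0 : ℝ), (hT.1.eigenvectorUnitary : Matrix n n ℝ) i k ^ 2
            * ((x + lam0)⁻¹ - (x + hT.1.eigenvalues k)⁻¹)
      = ∑ k, (hT.1.eigenvectorUnitary : Matrix n n ℝ) i k ^ 2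
            * (Real.log (hT.1.eigenvalues k) - Real.log lam0) := by
        refine Finset.sum_congr rfl fun k _ => ?_
        rw [integral_const_mul, (hsc k).2]
    _ = ∑ k, (hT.1.eigenvectorUnitary : Matrix n n ℝ) i k * Real.log (hT.1.eigenvalues k)
            * (hT.1.eigenvectorUnitary : Matrix n n ℝ) i k
          - (∑ k, (hT.1.eigenvectorUnitary : Matrix n n ℝ) i k ^ 2) * Real.log lam0 := by
        rw [Finset.sum_mul, ← Finset.sum_sub_distrib]
        exact Finset.sum_congr rfl fun k _ => by ring
    _ = _ := by rw [h1, one_mul]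

/-- **(3.37), first bracket, WITH THE CORRECTED SIGN, per diagonal entry**:
`−½ log λ₀ − ½ ∫₀^∞ dλ (λ₀ + λ)⁻¹((T − λ₀I)(T + λI)⁻¹)(i, i) = −½ (log T)(i, i)`. [folklore] -/
theorem eq337_first_corrected (hT : T.PosDef) {lam0 : ℝ} (h0 : 0 < lam0) (i : n) :
    -(1 / 2 : ℝ) * Real.log lam0
        - (1 / 2 : ℝ) * ∫ x in Ioi (0 : ℝ),
            (lam0 + x)⁻¹ * ((T - lam0 • (1 : Matrix n n ℝ)) * (T + x • 1)⁻¹) i i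
      = -(1 / 2 : ℝ) * (cfc Real.log T) i i := by
  rw [(integral_337_diag hT h0 i).2]; ring

/-- **The (3.38) bookkeeping for the first bracket of (3.37)**: summed over ALL diagonal indices ("Σ_{b∈Λ^{(k)}_{k+1}}"),
the corrected per-entry brackets give `−½ Tr log T = −½ log det T`, i.e. exactly the corrected (3.36). [folklore] -/
theorem sum_eq337_first (hT : T.PosDef) {lam0 : ℝ} (h0 : 0 < lam0) :
    ∑ i, (-(1 / 2 : ℝ) * Real.log lam0
        - (1 / 2 : ℝ) * ∫ x in Ioi (0 : ℝ),
            (lam0 + x)⁻¹ * ((T - lam0 • (1 : Matrix n n ℝ)) * (T + x • 1)⁻¹) i i)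
      = -(1 / 2 : ℝ) * Real.log T.det := by
  rw [Finset.sum_congr rfl fun i _ => eq337_first_corrected hT h0 i, ← Finset.mul_sum,
    log_det_eq_trace_log hT]
  simp [Matrix.trace, Matrix.diag]

/-- **The same, grouped along an arbitrary fibre map `bond : n → β`** (B14's "tr( · )(b, b)" read as the sum of the
diagonal entries in the fibre of the bond `b`): per bond the constant is `−½ log λ₀ · |fibre b|`, the fibre integrand is
integrable, and `Σ_b [−½ log λ₀ · |fibre b| − ½ ∫₀^∞ dλ (λ₀ + λ)⁻¹ Σ_{i ∈ fibre b} ((T − λ₀I)(T + λI)⁻¹)(i, i)]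
= −½ log det T`.  (The count `|fibre b|` multiplying `log λ₀` is the linear-algebra content of cell GAPS.md G-adv4-26 (b).)
[folklore] -/
theorem sum_fiber_eq337_first {β : Type*} [Fintype β] [DecidableEq β] (bond : n → β)
    (hT : T.PosDef) {lam0 : ℝ} (h0 : 0 < lam0) :
    ∑ b, (-(1 / 2 : ℝ) * Real.log lam0 * #{i | bond i = b}
        - (1 / 2 : ℝ) * ∫ x in Ioi (0 : ℝ), (lam0 + x)⁻¹
            * ∑ i ∈ univ.filter (fun i => bond i = b), ((T - lam0 • (1 : Matrix n n ℝ)) * (T + x • 1)⁻¹) i i)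
      = -(1 / 2 : ℝ) * Real.log T.det := by
  have hb : ∀ b : β,
      (-(1 / 2 : ℝ) * Real.log lam0 * #{i | bond i = b}
        - (1 / 2 : ℝ) * ∫ x in Ioi (0 : ℝ), (lam0 + x)⁻¹
            * ∑ i ∈ univ.filter (fun i => bond i = b), ((T - lam0 • (1 : Matrix n n ℝ)) * (T + x • 1)⁻¹) i i)
        = ∑ i ∈ univ.filter (fun i => bond i = b), (-(1 / 2 : ℝ) * (cfc Real.log T) i i) := by
    intro b
    have hI : ∫ x in Ioi (0 : ℝ), (lam0 + x)⁻¹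
          * ∑ i ∈ univ.filter (fun i => bond i = b), ((T - lam0 • (1 : Matrix n n ℝ)) * (T + x • 1)⁻¹) i i
        = ∑ i ∈ univ.filter (fun i => bond i = b), ((cfc Real.log T) i i - Real.log lam0) := by
      rw [← Finset.sum_congr rfl fun i _ => (integral_337_diag hT h0 i).2,
        ← integral_finsetSum _ (fun i _ => (integral_337_diag hT h0 i).1)]
      refine setIntegral_congr_fun measurableSet_Ioi fun x _ => ?_
      simp only [Finset.mul_sum]
    rw [hI, Finset.sum_sub_distrib, Finset.sum_const, nsmul_eq_mul, ← Finset.mul_sum]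
    simp only [Finset.card_filter]
    ring
  rw [Finset.sum_congr rfl fun b _ => hb b, Finset.sum_fiberwise univ bond (fun i => -(1 / 2 : ℝ) * (cfc Real.log T) i i),
    ← Finset.mul_sum, log_det_eq_trace_log hT]
  simp [Matrix.trace, Matrix.diag]

end Literature.MathematicalPhysics.QuantumFieldTheory.Balaban1983to89.B14LogDet336Matrix
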